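import Summits.CriticalPhenomena.SAWScalingLimit.Theses.SAWRenewalTightness

/-!
# `ShellCrossingBound` — negative knowledge: the crux is implied by the route's target

Support file for crux `stmt-CriticalPhenomena-4728` (refuter `cdisprove`, standing adversary; the
full indexed work file is `Summits/CriticalPhenomena/SAWScalingLimit/Cruxes/ShellCrossingBound/Disproof.lean`).

* `not_eventualTight_of_not_shellCrossingBound : ¬ ShellCrossingBound → ¬ EventualTight`, i.e.
  `EventualTight → ShellCrossingBound` in negative form (sorry-free). Since the threshold
  `k : ℂ → ℝ → ℝ → ℕ` of the crux is chosen PER SHELL while only `K, λ` are uniform,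
  tightness of the pushed-forward critical SAW laws already yields the bound: on a compact set of
  curve classes the number of separate traversals of a genuine shell is bounded
  (`exists_forall_not_hasTraversals_of_isCompact`). With the support item `TightOfShellCrossing`
  (the proved Aizenman–Burchard criterion) the crux is EQUIVALENT to the target `EventualTight`
  (stmt-CriticalPhenomena-1372): a disproof of the crux would disprove tightness of the critical
  `ℤ²` SAW, i.e. the conjunct. This mechanises the route-review remark of 2026-08-15 on the item.
* `anyTarget_of_eventualTight`, `anyExponent_of_eventualTight`: the Aizenman–Burchard dress
  (`K`, `λ > 2`, `δ ≤ ρ`, `R ≤ 1`) is not load-bearing — given the target, ANY positive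
  shell-dependent bound holds on all genuine shells.
* `bound_of_isTightMeasureSet`: dropping `IsEndpointApprox` exposes nothing to junk (arbitrary
  endpoint functions, any index set `T`).
* The shell-INDEPENDENT threshold (AB (H1) proper) is the natural strengthening with content; its
  (paper) refutation by Jordan boundary forcing is recorded in the work file.
-/

noncomputable section

open Set Filter Topology Metric MeasureTheory
open scoped unitInterval ENNReal
open Literature.Probability.RandomPlanarGeometry Literature.Probability.LatticeModels

namespace Summit.CriticalPhenomena.SAWScalingLimit.Theorems.ShellCrossingBound.Negative

open Summit.CriticalPhenomena.SAWScalingLimit.Theses.SAWRenewalTightness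

/-! ## §1 Deterministic stability of separate traversals -/

section Stability

variable {E : Type*} [PseudoMetricSpace E]

/-- Separate traversals are invariant under increasing reparametrisation. [folklore] -/
theorem hasTraversals_reparam_iff (γ : Curve E) (φ : I ≃o I) (k : ℕ) (x : E) (r R : ℝ) :
    (γ.reparam φ).HasTraversals k x r R ↔ γ.HasTraversals k x r R := by
  constructor
  · rintro ⟨s, t, hst, hsep⟩
    refine ⟨φ ∘ s, φ ∘ t, fun i => ?_, fun i j hij => φ.lt_iff_lt.2 (hsep hij)⟩
    obtain ⟨hle, h⟩ := hst i
    exact ⟨φ.le_iff_le.2 hle, by simpa [Curve.reparam_apply] using h⟩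
  · rintro ⟨s, t, hst, hsep⟩
    refine ⟨φ.symm ∘ s, φ.symm ∘ t, fun i => ?_, fun i j hij => φ.symm.lt_iff_lt.2 (hsep hij)⟩
    obtain ⟨hle, h⟩ := hst i
    refine ⟨φ.symm.le_iff_le.2 hle, ?_⟩
    simpa [Curve.IsTraversal, Curve.reparam_apply, OrderIso.apply_symm_apply] using h

/-- Perturbation: if two parametrised curves are at sup distance `≤ η`, then `k` separate
traversals of `D(x; r, R)` by the second give `k` separate traversals of the shrunk shell
`D(x; r + η, R - η)` by the first (same parameter intervals). [folklore] -/
theorem hasTraversals_of_dist_toContinuousMap_le {γ₁ γ₂ : Curve E} {η : ℝ}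
    (h : dist γ₁.toContinuousMap γ₂.toContinuousMap ≤ η) {k : ℕ} {x : E} {r R : ℝ}
    (h₂ : γ₂.HasTraversals k x r R) : γ₁.HasTraversals k x (r + η) (R - η) := by
  obtain ⟨s, t, hst, hsep⟩ := h₂
  refine ⟨s, t, fun i => ?_, hsep⟩
  obtain ⟨hle, hor⟩ := hst i
  have hd : ∀ u : I, dist (γ₁ u) (γ₂ u) ≤ η := fun u =>
    (ContinuousMap.dist_apply_le_dist (f := γ₁.toContinuousMap) (g := γ₂.toContinuousMap) u).trans h
  refine ⟨hle, ?_⟩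
  rcases hor with ⟨h1, h2⟩ | ⟨h1, h2⟩
  · left
    constructor
    · linarith [dist_triangle (γ₁ (s i)) (γ₂ (s i)) x, hd (s i)]
    · linarith [dist_triangle (γ₂ (t i)) (γ₁ (t i)) x, hd (t i), dist_comm (γ₁ (t i)) (γ₂ (t i))]
  · right
    constructor
    · linarith [dist_triangle (γ₂ (s i)) (γ₁ (s i)) x, hd (s i), dist_comm (γ₁ (s i)) (γ₂ (s i))]
    · linarith [dist_triangle (γ₁ (t i)) (γ₂ (t i)) x, hd (t i)]

/-- Perturbation in the reparametrisation distance: curves at distance `< η` have the same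
number of separate traversals up to shrinking the shell by `η` on each side. [folklore] -/
theorem hasTraversals_of_dist_lt {γ₁ γ₂ : Curve E} {η : ℝ} (h : dist γ₁ γ₂ < η) {k : ℕ} {x : E}
    {r R : ℝ} (h₂ : γ₂.HasTraversals k x r R) : γ₁.HasTraversals k x (r + η) (R - η) := by
  obtain ⟨φ, hφ⟩ := Curve.exists_dist_reparam_lt h
  exact hasTraversals_of_dist_toContinuousMap_le hφ.le ((hasTraversals_reparam_iff γ₂ φ k x r R).2 h₂)

/-- **On a compact set of curve classes the number of separate traversals of a genuine shell is
bounded.** If not, pick `γₙ` in the set with `n` traversals of `D(x; r, R)`; a subsequence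
converges to some class `[γ₀]`; but `γ₀` traverses the shrunk shell `D(x; r + η, R - η)`,
`η = (R - r)/3`, only `< k₀` times (`Curve.exists_not_hasTraversals`), while every `γₙ` close to
`γ₀` with `n ≥ k₀` transfers `k₀` traversals to it (`hasTraversals_of_dist_lt`). [folklore] -/
theorem exists_forall_not_hasTraversals_of_isCompact {𝒦 : Set (CurveClass E)}
    (h𝒦 : IsCompact 𝒦) (x : E) {r R : ℝ} (hrR : r < R) :
    ∃ k, ∀ γ : Curve E, CurveClass.mk γ ∈ 𝒦 → ¬ γ.HasTraversals k x r R := by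
  by_contra hcon
  push Not at hcon
  choose γ hγmem hγtrav using hcon
  obtain ⟨c, -, φ, hφ, hlim⟩ := h𝒦.isSeqCompact hγmem
  obtain ⟨γ₀, rfl⟩ := CurveClass.surjective_mk c
  set η : ℝ := (R - r) / 3 with hη
  have hη0 : 0 < η := by rw [hη]; linarith
  obtain ⟨k₀, hk₀⟩ :=
    Curve.exists_not_hasTraversals γ₀ x (r := r + η) (R := R - η) (by rw [hη]; linarith)
  rw [Metric.tendsto_atTop] at hlim
  obtain ⟨N, hN⟩ := hlim η hη0
  have hn := hN (max N k₀) (le_max_left _ _)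
  simp only [Function.comp_apply, CurveClass.mk_eq_separationQuotientMk,
    SeparationQuotient.dist_mk] at hn
  have htrav : (γ (φ (max N k₀))).HasTraversals k₀ x r R :=
    (hγtrav _).of_le ((le_max_right N k₀).trans (hφ.id_le _))
  rw [dist_comm] at hn
  exact hk₀ (hasTraversals_of_dist_lt hn htrav)

end Stability

/-! ## §2 The sandwich: tightness already gives every shell bound -/

/-- **Tightness ⇒ arbitrary shell-dependent crossing bounds.** If the pushed-forward SAW laws
`(law Ω δ (a δ) (b δ)).map curve`, `δ ∈ T`, form a tight set, then for EVERY target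
`f : ℂ → ℝ → ℝ → ℝ≥0∞`, positive on genuine shells `0 < ρ < R`, there is a shell-dependent
threshold `k` with `P_δ[k x ρ R separate traversals of D(x; ρ, R)] ≤ f x ρ R` for all `δ ∈ T`
and all genuine shells — no mesh lower bound `δ ≤ ρ`, no `R ≤ 1`, endpoints arbitrary.
Proof: tightness gives a compact `𝒦 ⊆ CurveClass ℂ` carrying all but `f x ρ R` of every law;
take `k` from `exists_forall_not_hasTraversals_of_isCompact`. [folklore] -/
theorem targets_of_isTightMeasureSet (Ω : Set ℂ) (a b : ℝ → Site 2) (T : Set ℝ)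
    (htight : IsTightMeasureSet
      ((fun δ => (SAW.law Ω δ (a δ) (b δ)).map (fun γ => γ.curve)) '' T))
    (f : ℂ → ℝ → ℝ → ℝ≥0∞) (hf : ∀ x ρ R, 0 < ρ → ρ < R → f x ρ R ≠ 0) :
    ∃ k : ℂ → ℝ → ℝ → ℕ, ∀ δ ∈ T, ∀ (x : ℂ) (ρ R : ℝ), 0 < ρ → ρ < R →
      SAW.law Ω δ (a δ) (b δ)
        {γ | (⟨γ.walk.toCurve (meshPoint δ)⟩ : Curve ℂ).HasTraversals (k x ρ R) x ρ R} ≤ f x ρ R := by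
  rw [isTightMeasureSet_iff_exists_isCompact_measure_compl_le] at htight
  have key : ∀ (x : ℂ) (ρ R : ℝ), ∃ k : ℕ, 0 < ρ → ρ < R → ∀ δ ∈ T,
      SAW.law Ω δ (a δ) (b δ)
        {γ | (⟨γ.walk.toCurve (meshPoint δ)⟩ : Curve ℂ).HasTraversals k x ρ R} ≤ f x ρ R := by
    intro x ρ R
    by_cases hρR : 0 < ρ ∧ ρ < R
    · obtain ⟨𝒦, h𝒦, hμ⟩ := htight (f x ρ R) (pos_iff_ne_zero.2 (hf x ρ R hρR.1 hρR.2))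
      obtain ⟨k, hk⟩ := exists_forall_not_hasTraversals_of_isCompact h𝒦 x hρR.2
      refine ⟨k, fun _ _ δ hδ => ?_⟩
      calc SAW.law Ω δ (a δ) (b δ)
            {γ | (⟨γ.walk.toCurve (meshPoint δ)⟩ : Curve ℂ).HasTraversals k x ρ R}
          ≤ SAW.law Ω δ (a δ) (b δ) ((fun γ => γ.curve) ⁻¹' 𝒦ᶜ) := by
            refine measure_mono fun γ hγ => ?_
            exact fun hmem => hk _ hmem hγ
        _ ≤ ((SAW.law Ω δ (a δ) (b δ)).map (fun γ => γ.curve)) 𝒦ᶜ :=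
            Measure.le_map_apply (SAW.aemeasurable_curve _ _ _ _) _
        _ ≤ f x ρ R := hμ _ ⟨δ, hδ, rfl⟩
    · exact ⟨0, fun h1 h2 => absurd ⟨h1, h2⟩ hρR⟩
  choose k hk using key
  exact ⟨k, fun δ hδ x ρ R hρ hρR => hk x ρ R hρ hρR δ hδ⟩

/-- **Every positive shell-dependent target is met under `EventualTight`.** For every Dobrushin
domain and endpoint approximation, with the `δ₀` of `EventualTight`: for every target `f`,
positive on genuine shells, some shell-dependent threshold achieves
`P_δ[k x ρ R traversals] ≤ f x ρ R` for all `δ ∈ (0, δ₀]`, all `x`, all `0 < ρ < R`. [folklore] -/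
theorem anyTarget_of_eventualTight (hT : EventualTight) (D : DobrushinDomain) (a b : ℝ → Site 2)
    (hab : SAW.IsEndpointApprox D a b) :
    ∃ δ₀ : ℝ, 0 < δ₀ ∧ ∀ f : ℂ → ℝ → ℝ → ℝ≥0∞, (∀ x ρ R, 0 < ρ → ρ < R → f x ρ R ≠ 0) →
      ∃ k : ℂ → ℝ → ℝ → ℕ, ∀ δ ∈ Set.Ioc (0 : ℝ) δ₀, ∀ (x : ℂ) (ρ R : ℝ), 0 < ρ → ρ < R →
        SAW.law D.carrier δ (a δ) (b δ)
          {γ | (⟨γ.walk.toCurve (meshPoint δ)⟩ : Curve ℂ).HasTraversals (k x ρ R) x ρ R} ≤ f x ρ R := by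
  obtain ⟨δ₀, hδ₀, htight⟩ := hT D a b hab
  exact ⟨δ₀, hδ₀, fun f hf => targets_of_isTightMeasureSet D.carrier a b _ htight f hf⟩

/-- **A disproof of the crux disproves the route's target** (`¬ ShellCrossingBound → ¬ EventualTight`),
i.e. `EventualTight → ShellCrossingBound` in refuter-admissible (negative) form: given the `δ₀` of
`EventualTight`, take `K = 1`, `λ = 3` and the shell-dependent threshold of
`anyTarget_of_eventualTight` for the target `(ρ/R)^3`. With the support item
`TightOfShellCrossing` the crux is therefore EQUIVALENT to the target (stmt-CriticalPhenomena-1372),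
and refuting it means refuting tightness of the critical `ℤ²` SAW laws — WHY the crux resists
disproof. [folklore] -/
theorem not_eventualTight_of_not_shellCrossingBound (h : ¬ ShellCrossingBound) : ¬ EventualTight := by
  intro hT
  apply h
  intro D a b hab
  obtain ⟨δ₀, hδ₀, H⟩ := anyTarget_of_eventualTight hT D a b hab
  obtain ⟨k, hk⟩ := H (fun x ρ R => ENNReal.ofReal (1 * (ρ / R) ^ (3 : ℝ))) (by
    intro x ρ R hρ hρR
    have hR : 0 < R := hρ.trans hρR
    have : 0 < 1 * (ρ / R) ^ (3 : ℝ) := by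
      rw [one_mul]
      exact Real.rpow_pos_of_pos (div_pos hρ hR) _
    exact (ENNReal.ofReal_pos.2 this).ne')
  refine ⟨k, 1, 3, δ₀, by norm_num, hδ₀, fun δ hδ x ρ R hδρ hρR _ => ?_⟩
  exact hk δ hδ x ρ R (hδ.1.trans_le hδρ) hρR

/-! ## §3 The Aizenman–Burchard dress is not load-bearing -/

/-- Given the target, the crux holds with ANY `K > 0` and ANY real exponent `λ`, with no mesh lower
bound on `ρ` (only `0 < ρ`) and no `R ≤ 1` — a formally much stronger statement than the crux
(`2 < λ`, `δ ≤ ρ`, `R ≤ 1`), with the SAME `δ₀` for all `K, λ`. So the constants of the crux carry no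
information beyond `EventualTight`. [folklore] -/
theorem anyExponent_of_eventualTight (hT : EventualTight) (D : DobrushinDomain) (a b : ℝ → Site 2)
    (hab : SAW.IsEndpointApprox D a b) :
    ∃ δ₀ : ℝ, 0 < δ₀ ∧ ∀ (K lam : ℝ), 0 < K → ∃ (k : ℂ → ℝ → ℝ → ℕ),
      ∀ δ ∈ Set.Ioc (0 : ℝ) δ₀, ∀ (x : ℂ) (ρ R : ℝ), 0 < ρ → ρ < R →
        SAW.law D.carrier δ (a δ) (b δ)
          {γ | (⟨γ.walk.toCurve (meshPoint δ)⟩ : Curve ℂ).HasTraversals (k x ρ R) x ρ R}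
            ≤ ENNReal.ofReal (K * (ρ / R) ^ lam) := by
  obtain ⟨δ₀, hδ₀, H⟩ := anyTarget_of_eventualTight hT D a b hab
  refine ⟨δ₀, hδ₀, fun K lam hK => ?_⟩
  obtain ⟨k, hk⟩ := H (fun x ρ R => ENNReal.ofReal (K * (ρ / R) ^ lam)) (by
    intro x ρ R hρ hρR
    have hR : 0 < R := hρ.trans hρR
    have : 0 < K * (ρ / R) ^ lam := mul_pos hK (Real.rpow_pos_of_pos (div_pos hρ hR) _)
    exact (ENNReal.ofReal_pos.2 this).ne')
  exact ⟨k, hk⟩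

/-- Dropping the only external hypothesis `IsEndpointApprox` exposes nothing to junk: for
ARBITRARY endpoint functions `a b : ℝ → Site 2`, tightness of the pushed laws over `δ ∈ T` already
gives the crux's bound over `T` (coincident endpoints: Dirac mass at a constant curve, which
traverses no genuine shell; unreachable endpoints: zero law). Hence no
`_false_without_IsEndpointApprox` theorem exists short of refuting SAW tightness for some endpoint
choice. [folklore] -/
theorem bound_of_isTightMeasureSet (D : DobrushinDomain) (a b : ℝ → Site 2) (T : Set ℝ)
    (htight : IsTightMeasureSet
      ((fun δ => (SAW.law D.carrier δ (a δ) (b δ)).map (fun γ => γ.curve)) '' T)) :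
    ∃ (k : ℂ → ℝ → ℝ → ℕ), ∀ δ ∈ T, ∀ (x : ℂ) (ρ R : ℝ), 0 < ρ → ρ < R →
      SAW.law D.carrier δ (a δ) (b δ)
        {γ | (⟨γ.walk.toCurve (meshPoint δ)⟩ : Curve ℂ).HasTraversals (k x ρ R) x ρ R}
          ≤ ENNReal.ofReal (1 * (ρ / R) ^ (3 : ℝ)) :=
  targets_of_isTightMeasureSet D.carrier a b T htight _ (by
    intro x ρ R hρ hρR
    have hR : 0 < R := hρ.trans hρR
    have : 0 < 1 * (ρ / R) ^ (3 : ℝ) := by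
      rw [one_mul]
      exact Real.rpow_pos_of_pos (div_pos hρ hR) _
    exact (ENNReal.ofReal_pos.2 this).ne')

end Summit.CriticalPhenomena.SAWScalingLimit.Theorems.ShellCrossingBound.Negative
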